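import Summits.HodgeConjecture.HodgeConjecture.Theses.VHCAbelianSchemesRoad
import Summits.HodgeConjecture.HodgeConjecture.Theorems.VHCAbelianSchemesRoadSecantQuotientAnchorPinnedDefs
import Summits.HodgeConjecture.HodgeConjecture.Theorems.VHCAbelianSchemesRoadSecantQuotientAnchorPinnedDefsPrime
import Summits.HodgeConjecture.HodgeConjecture.Theorems.VHCAbelianSchemesRoadDegreeConfinementItems
import Summits.HodgeConjecture.HodgeConjecture.Theorems.VHCAbelianSchemesRoadTwistedDoorPrimeIsoRespects
import HarnessLib

/-!
# BC3 birth skeleton v3.3 (= v3.2 with the two `(6,3)` stubs BY NAME over ring2-b06 g121's primed sugar p547560, v3.1 style; no other change) — the line of record for the crux `SemiregularSheafRepresentativesTwPrimeAtDiag`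
# (item stmt-HodgeConjecture-20707, rank 2, born 2026-08-27T15:57:43Z at route rev 17) of route `VHCAbelianSchemesRoad`
# = the v3.1 skeleton of item stmt-HodgeConjecture-19787 (`Cruxes/SemiregularSheafRepresentativesTwAtDiag/Lines/birth.lean`, sha16 f9a79bf017e58d88)
# RE-POSED OVER THE PRIMED TWISTED DOOR `tw(C, AdmTw')`, `AdmTw' = gluableSigmaAdmissible ∨ bfSingleAdmissible'`,
# `bfSingleAdmissible' = bfSingleAdmissible ∧ I a shifted initial segment` — ring2 LEAD gen 157 (planner-pub-hodge-ring2-typer1-g155-0), 2026-08-27;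
# director-hodge g9 rulings R9.3 (package item (iii)), R9.4 (ADD-AND-REKEY approved, second leave), R9.5 (short path S1–S4); LEAD 157 DOOR-PRIME-PACKAGE.md
# 36e61c73e912c4e1 §iii (draft ccaa632612b25c59 / registrable e620c2412f7b9247 = this file before the header update); J pre-read g43 §2 / g44 0486d631511f83d3.

research route conditional on HC_CM; not a corollary; Q11.4-sentence-2 already refuted in dim ≥ 3.

WHAT CHANGES FROM v3.1: every occurrence of the door `tw(C, AdmTw)` becomes `tw(C, AdmTw')`
(`Literature/AlgebraicGeometry/HodgeTheory/TwistedPerfectAdmissibilityInitialSegment.lean`, p537197): stubs 1′, 3′, the rung, `_of_cells`; the two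
`(6,3)` stubs 2a‴ / 2b‴ are SPELLED over the 𝒪-generic predicates `AnchoredCarrierAt` ∕ `LefAtExceptionalRegimeAtUnder` at the PINNED anchor data
(`secantQuotientAnchorsPinned`, `secantQuotientServedClassesPinned` — unchanged, door-free) because the named defs
`SecantQuotient{AnchorCarrier,Residual}63Pinned C` are DEFINED over `tw(C, AdmTw)` (`…SecantQuotientAnchorPinnedDefs` §3; a primed-defs sugar file
may follow from ring2-b06 g121, not load-bearing); the rung glue is the 𝒪-generic `lefAtExceptionalRegimeSixfoldMiddle_of_anchoredCarrierAt_of_under_not`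
(`…ServedFibre`). The primed statements are STRONGER than v3.1's (`tw(C, AdmTw') ≤ tw(C, AdmTw)`: `twistedReflexiveClass_admTw_of_admTw'`; regime 2,
`AnchoredCarrierAt`, `…Under` monotone in the door): on the BF-disjunct a carrier must be `I`-semiregular on a shifted INITIAL SEGMENT with ALL lower
classes flat-compatible (at `(6,3)`: `κ₂ ∈ ℂθ²` — the honest price of the print-exact door, package §iv); Markman's secant–quotient sheaf is σ-admissible,
so 2a‴ has the same print contact as 2a″. `_of` concludes the ROUTE DECL `SemiregularSheafRepresentativesTwPrimeAtDiag` BY NAME (no formal edge `N₁ → 19787` in this file: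
it is `LefAtExceptionalRegimeAt.mono ∘ twistedReflexiveClass_admTw_of_admTw'`, kernel-checked in the LEAD's draft and by J g44; item 19787's v3.1
skeleton, 87 helper files and evidence chain stay the record of the cells' content).
BC5 PLAN-ONLY rung designate: `stub_residual_63_secantQuotientPinnedPrime` (J g43/g44: T3 plan-only on the v3.2 (6,3) twin).
Nothing here says any cell, carrier, residual, design, VHC, HC_AV, HC_CM or HC holds; sorries live ONLY in the four `stub_*`.
-/
noncomputable section

open Literature.AlgebraicGeometry.HodgeTheory (ChernCharacterBetti)
open Summit.HodgeConjecture.HodgeConjecture.Ring2.SemiregularRepresentatives (LefAtExceptionalRegimeAt LefAtExceptionalRegimeSixfoldMiddle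
  lefAtExceptionalRegimeSixfoldMiddle_iff_at AnchoredCarrierAt LefAtExceptionalRegimeAtUnder HasServedFibre secantQuotientAnchorsPinned
  secantQuotientServedClassesPinned lefAtExceptionalRegimeSixfoldMiddle_of_anchoredCarrierAt_of_under_not twistedReflexiveClass_admTw_of_admTw'
  SecantQuotientAnchorCarrier63PinnedPrime SecantQuotientResidual63PinnedPrime
  rung_sixfoldMiddleTwPrime_of_secantQuotientAnchorCarrier63PinnedPrime_of_residual63PinnedPrime)

namespace Summit.HodgeConjecture.HodgeConjecture.Cruxes.SemiregularSheafRepresentativesTwPrimeAtDiag.Birth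

set_option linter.dupNamespace false

/-! ## The v3.3 skeleton proper (primed door spelled inline in stubs 1′ ∕ 3′: `fun n X₀ I E => gluableSigmaAdmissible n X₀ I E ∨ bfSingleAdmissible' n X₀ I E`; stubs 2a‴ ∕ 2b‴ by their primed names) -/

/-- STUB 1′ (size XL, research; MECHANISM cell): regime 2 over the PRIMED twisted door at `(4, 2)` — abelian fourfold pencils, codimension 2. -/
theorem stub_firstCell_fourfoldMiddleTwPrime : ∀ C : ChernCharacterBetti,
    LefAtExceptionalRegimeAt (Literature.AlgebraicGeometry.HodgeTheory.twistedReflexiveClass C (fun n X₀ I E => Summit.Ventures.HSemireg.gluableSigmaAdmissible n X₀ I E ∨ Literature.AlgebraicGeometry.HodgeTheory.bfSingleAdmissible' n X₀ I E)) 4 2 := by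
  sorry

/-- STUB 2a‴ (size L; CITATION-EXPECTED at print's anchors, PREPRINT-GATED; OPEN beyond gaps (G1), (G3)): the PINNED ANCHORED CARRIER at `(6, 3)`
OVER THE PRIMED DOOR — at every pinned secant–quotient anchor `(X, θ)` and every pinned-served rational class `γ` off the ray, an
`AdmTw'`-admissible `B`-twisted datum with `κ₃ = a·γ + c·θ³`, `a ≠ 0`, lower classes on the `θ`-ray (Markman's `𝓔̄ ⊗ det^{-1/8d}`, arXiv:2502.03415
Thm 1.4.1 ∕ §1.5 ∕ Lemma 9.3.11 ∕ Remark 9.3.7, unrefereed — a `σ`-admissible complex, so the σ-disjunct carries it exactly as under `AdmTw`).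
Implies v3.1's 2a″ (door monotonicity). BY NAME over `SecantQuotientAnchorCarrier63PinnedPrime` (p547560, ring2-b06 g121), which unfolds
DEFINITIONALLY to `AnchoredCarrierAt (tw C AdmTw') 6 3 𝔄^pin 𝔖^pin` (the v3.2 inline text pre-read by J g44). -/
theorem stub_anchorCarrier_63_secantQuotientPinnedPrime : ∀ C : ChernCharacterBetti, SecantQuotientAnchorCarrier63PinnedPrime C := by
  sorry

/-- STUB 2b‴ = PROPOSED BC5 PLAN-ONLY RUNG-DESIGNATE (size XL; the SEPARATING content): regime 2 at `(6, 3)` OVER THE PRIMED DOOR for the abelian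
sixfold pencils with NO PINNED-served secant–quotient fibre. Implies v3.1's 2b″ (door monotonicity); implied by the primed rung fact-free
(`under_of_lefAtExceptionalRegimeAt _ (lefAtExceptionalRegimeSixfoldMiddle_iff_at.1 h)`, one line, not stated here to keep the file orphan-free); NOT known to imply it. BY NAME over `SecantQuotientResidual63PinnedPrime` (p547560), definitionally
`LefAtExceptionalRegimeAtUnder (tw C AdmTw') 6 3 (¬ HasServedFibre 6 3 𝔄^pin 𝔖^pin)` (the v3.2 inline text). -/
theorem stub_residual_63_secantQuotientPinnedPrime : ∀ C : ChernCharacterBetti, SecantQuotientResidual63PinnedPrime C := by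
  sorry

/-- STUB 3′ (size XL, research; the TAIL): regime 2 over the PRIMED twisted door at every diagonal cell `(2m, m)`, `m ≥ 4` — no print contact. -/
theorem stub_diagonalTailTwPrime : ∀ (C : ChernCharacterBetti) (m : ℕ), 4 ≤ m →
    LefAtExceptionalRegimeAt (Literature.AlgebraicGeometry.HodgeTheory.twistedReflexiveClass C (fun n X₀ I E => Summit.Ventures.HSemireg.gluableSigmaAdmissible n X₀ I E ∨ Literature.AlgebraicGeometry.HodgeTheory.bfSingleAdmissible' n X₀ I E)) (2 * m) m := by
  sorry

/-- The PRIMED `(6, 3)` RUNG, a THEOREM from STUB 2a‴ + STUB 2b‴ via ring2-b06 g121's fact-free glue BY NAME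
`rung_sixfoldMiddleTwPrime_of_secantQuotientAnchorCarrier63PinnedPrime_of_residual63PinnedPrime` (p547560; = `lefAtExceptionalRegimeSixfoldMiddle_of_anchoredCarrierAt_of_under_not` pointwise; sorryAx reaches it only through the two stubs). -/
theorem rung_sixfoldMiddleTwPrime : ∀ C : ChernCharacterBetti, LefAtExceptionalRegimeSixfoldMiddle (Literature.AlgebraicGeometry.HodgeTheory.twistedReflexiveClass C (fun n X₀ I E => Summit.Ventures.HSemireg.gluableSigmaAdmissible n X₀ I E ∨ Literature.AlgebraicGeometry.HodgeTheory.bfSingleAdmissible' n X₀ I E)) :=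
  rung_sixfoldMiddleTwPrime_of_secantQuotientAnchorCarrier63PinnedPrime_of_residual63PinnedPrime
    stub_anchorCarrier_63_secantQuotientPinnedPrime stub_residual_63_secantQuotientPinnedPrime

/-- **BC3 composition, hypothesis form (primed)** — the three primed cell statements give the PRIMED crux statement spelled out (case split on `m`). -/
theorem twPrimeAtDiag_of_cells
    (h₁ : ∀ C : ChernCharacterBetti,
      LefAtExceptionalRegimeAt (Literature.AlgebraicGeometry.HodgeTheory.twistedReflexiveClass C (fun n X₀ I E => Summit.Ventures.HSemireg.gluableSigmaAdmissible n X₀ I E ∨ Literature.AlgebraicGeometry.HodgeTheory.bfSingleAdmissible' n X₀ I E)) 4 2)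
    (h₂ : ∀ C : ChernCharacterBetti,
      LefAtExceptionalRegimeSixfoldMiddle (Literature.AlgebraicGeometry.HodgeTheory.twistedReflexiveClass C (fun n X₀ I E => Summit.Ventures.HSemireg.gluableSigmaAdmissible n X₀ I E ∨ Literature.AlgebraicGeometry.HodgeTheory.bfSingleAdmissible' n X₀ I E)))
    (h₃ : ∀ (C : ChernCharacterBetti) (m : ℕ), 4 ≤ m →
      LefAtExceptionalRegimeAt (Literature.AlgebraicGeometry.HodgeTheory.twistedReflexiveClass C (fun n X₀ I E => Summit.Ventures.HSemireg.gluableSigmaAdmissible n X₀ I E ∨ Literature.AlgebraicGeometry.HodgeTheory.bfSingleAdmissible' n X₀ I E)) (2 * m) m) :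
    ∀ (C : ChernCharacterBetti) (m : ℕ), 2 ≤ m →
      LefAtExceptionalRegimeAt (Literature.AlgebraicGeometry.HodgeTheory.twistedReflexiveClass C (fun n X₀ I E => Summit.Ventures.HSemireg.gluableSigmaAdmissible n X₀ I E ∨ Literature.AlgebraicGeometry.HodgeTheory.bfSingleAdmissible' n X₀ I E)) (2 * m) m := by
  intro C m hm
  rcases Nat.lt_or_ge m 4 with hlt | hge
  · interval_cases m
    · exact h₁ C
    · exact (lefAtExceptionalRegimeSixfoldMiddle_iff_at.1 (h₂ C))
  · exact h₃ C m hge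

/-- **BC3 composition** — concludes the ROUTE DECL `SemiregularSheafRepresentativesTwPrimeAtDiag` BY NAME from the four DECLARED stubs
(through the theorem `rung_sixfoldMiddleTwPrime`); no hypothesis; `sorryAx` reaches it only through `stub_*`. -/
theorem SemiregularSheafRepresentativesTwPrimeAtDiag_of :
    Summit.HodgeConjecture.HodgeConjecture.Theses.VHCAbelianSchemesRoad.SemiregularSheafRepresentativesTwPrimeAtDiag :=
  twPrimeAtDiag_of_cells stub_firstCell_fourfoldMiddleTwPrime rung_sixfoldMiddleTwPrime stub_diagonalTailTwPrime

#print axioms twPrimeAtDiag_of_cells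
#print axioms SemiregularSheafRepresentativesTwPrimeAtDiag_of

end Summit.HodgeConjecture.HodgeConjecture.Cruxes.SemiregularSheafRepresentativesTwPrimeAtDiag.Birth

end
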